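import Summits.CriticalPhenomena.PercolationContinuityZ3.Theorems.PercNearOneGluingNoHeavyQuantThreeClusterCutOff
import HarnessLib

/-!
# The product row F1 reduces to the residual `R₀` with constant `2`:
# `P(abc)·P(a|b|c) ≤ 2·[P(ab|c) + P(ac|b)] + P⊗P(R₀)`

builds on p205010 (kernel theorem, internal audit signed; external expert review pending)

Support file (`--supports stmt-CriticalPhenomena-4575`), seat `prim-quant-p1` (gen 42); memo
`run/shared/lean/prim/quant/prim-quant-p1-g42/FOR-LEAD-Z32-CUTOFF.md` §1–§2.  No definitions, no named facts, no sorries;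
standard axioms.

Assembly of ✓ p577001 `ThreeClusterSwap.productRow_le_add_Pr2W` (p1 g40: the two single SEALS, constant `1` + P⊗P(B)) with the
two CUT-OFF swaps of the companion file (`ThreeClusterSwap.Pr2W_cut_le`): the doubly-sealed-failure set `B` is covered by the
success sets of the two cut-offs (each a weight-preserving injection into one target cell) and the residual
`R₀ = B ∩ {both cut-offs fail}`:
* `Pr2W_B_le_add_Pr2W_R0` — `Pr2W(B) ≤ PrW{ab|c} + PrW{ac|b} + Pr2W(R₀)`;
* `productRow_le_two_add_Pr2W`, `productRow_le_two_add_Pr2W_prodBernoulli` — the product row with constant `2` plus `Pr2W(R₀)`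
  (finitary form / every finite weighted graph);
* `productRow_of_Pr2W_R0_bound` — `Pr2W(R₀) ≤ m·S ⟹ F1 ≤ 2 + m` (`m ≤ 1` feeds ✓ p560550
  `ThreePort.le_one_reached_le_of_productRow3`, the three-port case of `Z(3,2)`).
`R₀` explicitly: pairs `(C₂, C₁)` with `C₂ ∈ a|b|c`, `C₁ ∈ abc`, `a ↮ b` in `C₁` off the edges touching `C_c(C₂)`, `a ↮ c` in
`C₁` off the edges touching `C_b(C₂)`, `a ↮ b` in `C₁ ∖ E(Q_c, C_b(C₂))` and `a ↮ c` in `C₁ ∖ E(Q_b, C_c(C₂))`, where `Q_c` (`Q_b`)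
is the `C₁`-cluster of `c` (`b`) avoiding `C_b(C₂)` (`C_c(C₂)`).  Census (memo §3; exact enumeration, all graphs on ≤ 7 vertices
and multigraphs on ≤ 5): in the antithetic (coefficientwise) form `R₀` is empty on every graph with ≤ 5 vertices, 8 of 119 314
`TN`-configurations at 6 vertices, 1 572 of 13.2 M at 7; structurally, on `R₀` both `C_b(C₂) ∖ {b}` and `C_c(C₂) ∖ {c}`
separate `a` from `{b, c}` in `C₁`.
-/

namespace Summit.CriticalPhenomena.PercolationContinuityZ3.Theorems

open Literature.Probability.Percolation Literature.Probability.Percolation.DecisionTree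

variable {V : Type*}

namespace ThreeClusterSwap

section Reduction

open scoped Classical

variable [Fintype V] [DecidableEq V]

/-- **The doubly-sealed-failure set is bounded by the two target cells plus the residual `R₀`.**  For g40's set `B` of pairs
`(C₂, C₁)` (`C₂ ∈ a|b|c`, `C₁ ∈ abc`, both single seals failing):
`Pr2W(B) ≤ PrW{ab|c} + PrW{ac|b} + Pr2W(R₀)`, where `R₀ ⊆ B` adds the failure of BOTH cut-off swaps: `a ↮ b` in
`C₁ ∖ E(Q_c, S_b)` and `a ↮ c` in `C₁ ∖ E(Q_b, S_c)` (`S_t = C_t(C₂)`, `Q_c` = the `C₁`-cluster of `c` avoiding `S_b`, `Q_b`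
symmetric).  Proof: `B ⊆ (cut-off-to-c succeeds) ∪ (cut-off-to-b succeeds) ∪ R₀` and `Pr2W_cut_le` twice. [this work] -/
theorem Pr2W_B_le_add_Pr2W_R0 (p : Sym2 V → ℝ) (hp0 : ∀ e, 0 ≤ p e) (hp1 : ∀ e, p e ≤ 1) (a b c : V) :
    Pr2W Finset.univ p {x : Finset (Sym2 V) × Finset (Sym2 V) |
        (¬ (openGraph (↑x.1 : Set (Sym2 V))).Reachable a b ∧ ¬ (openGraph (↑x.1 : Set (Sym2 V))).Reachable a c ∧
          ¬ (openGraph (↑x.1 : Set (Sym2 V))).Reachable b c) ∧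
        ((openGraph (↑x.2 : Set (Sym2 V))).Reachable a b ∧ (openGraph (↑x.2 : Set (Sym2 V))).Reachable a c) ∧
        ¬ (openGraph ((↑x.2 : Set (Sym2 V)) \
            {e | ∃ v ∈ {v | (openGraph (↑x.1 : Set (Sym2 V))).Reachable c v}, v ∈ e})).Reachable a b ∧
        ¬ (openGraph ((↑x.2 : Set (Sym2 V)) \
            {e | ∃ v ∈ {v | (openGraph (↑x.1 : Set (Sym2 V))).Reachable b v}, v ∈ e})).Reachable a c} ≤
    PrW Finset.univ p {S : Finset (Sym2 V) | (openGraph (↑S : Set (Sym2 V))).Reachable a b ∧ ¬ (openGraph (↑S : Set (Sym2 V))).Reachable a c} +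
    PrW Finset.univ p {S : Finset (Sym2 V) | (openGraph (↑S : Set (Sym2 V))).Reachable a c ∧ ¬ (openGraph (↑S : Set (Sym2 V))).Reachable a b} +
    Pr2W Finset.univ p {x : Finset (Sym2 V) × Finset (Sym2 V) |
        (¬ (openGraph (↑x.1 : Set (Sym2 V))).Reachable a b ∧ ¬ (openGraph (↑x.1 : Set (Sym2 V))).Reachable a c ∧
          ¬ (openGraph (↑x.1 : Set (Sym2 V))).Reachable b c) ∧
        ((openGraph (↑x.2 : Set (Sym2 V))).Reachable a b ∧ (openGraph (↑x.2 : Set (Sym2 V))).Reachable a c) ∧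
        ¬ (openGraph ((↑x.2 : Set (Sym2 V)) \
            {e | ∃ v ∈ {v | (openGraph (↑x.1 : Set (Sym2 V))).Reachable c v}, v ∈ e})).Reachable a b ∧
        ¬ (openGraph ((↑x.2 : Set (Sym2 V)) \
            {e | ∃ v ∈ {v | (openGraph (↑x.1 : Set (Sym2 V))).Reachable b v}, v ∈ e})).Reachable a c ∧
        ¬ (openGraph ((↑x.2 : Set (Sym2 V)) \
            {e | ∃ q ∈ {q | (openGraph ((↑x.2 : Set (Sym2 V)) \
                  {e | ∃ v ∈ {v | (openGraph (↑x.1 : Set (Sym2 V))).Reachable b v}, v ∈ e})).Reachable c q},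
                 ∃ s ∈ {v | (openGraph (↑x.1 : Set (Sym2 V))).Reachable b v}, e = s(q, s)})).Reachable a b ∧
        ¬ (openGraph ((↑x.2 : Set (Sym2 V)) \
            {e | ∃ q ∈ {q | (openGraph ((↑x.2 : Set (Sym2 V)) \
                  {e | ∃ v ∈ {v | (openGraph (↑x.1 : Set (Sym2 V))).Reachable c v}, v ∈ e})).Reachable b q},
                 ∃ s ∈ {v | (openGraph (↑x.1 : Set (Sym2 V))).Reachable c v}, e = s(q, s)})).Reachable a c} := by
  set D : Finset (Sym2 V) := Finset.univ with hD
  set Kc : Set (Finset (Sym2 V) × Finset (Sym2 V)) := {x : Finset (Sym2 V) × Finset (Sym2 V) |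
        ¬ (openGraph (↑x.1 : Set (Sym2 V))).Reachable b c ∧
        ¬ (openGraph ((↑x.2 : Set (Sym2 V)) \
            {e | ∃ v ∈ {v | (openGraph (↑x.1 : Set (Sym2 V))).Reachable b v}, v ∈ e})).Reachable a c ∧
        (openGraph ((↑x.2 : Set (Sym2 V)) \
            {e | ∃ q ∈ {q | (openGraph ((↑x.2 : Set (Sym2 V)) \
                  {e | ∃ v ∈ {v | (openGraph (↑x.1 : Set (Sym2 V))).Reachable b v}, v ∈ e})).Reachable c q},
                 ∃ s ∈ {v | (openGraph (↑x.1 : Set (Sym2 V))).Reachable b v}, e = s(q, s)})).Reachable a b} with hKc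
  set Kb : Set (Finset (Sym2 V) × Finset (Sym2 V)) := {x : Finset (Sym2 V) × Finset (Sym2 V) |
        ¬ (openGraph (↑x.1 : Set (Sym2 V))).Reachable c b ∧
        ¬ (openGraph ((↑x.2 : Set (Sym2 V)) \
            {e | ∃ v ∈ {v | (openGraph (↑x.1 : Set (Sym2 V))).Reachable c v}, v ∈ e})).Reachable a b ∧
        (openGraph ((↑x.2 : Set (Sym2 V)) \
            {e | ∃ q ∈ {q | (openGraph ((↑x.2 : Set (Sym2 V)) \
                  {e | ∃ v ∈ {v | (openGraph (↑x.1 : Set (Sym2 V))).Reachable c v}, v ∈ e})).Reachable b q},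
                 ∃ s ∈ {v | (openGraph (↑x.1 : Set (Sym2 V))).Reachable c v}, e = s(q, s)})).Reachable a c} with hKb
  set R0 : Set (Finset (Sym2 V) × Finset (Sym2 V)) := {x : Finset (Sym2 V) × Finset (Sym2 V) |
        (¬ (openGraph (↑x.1 : Set (Sym2 V))).Reachable a b ∧ ¬ (openGraph (↑x.1 : Set (Sym2 V))).Reachable a c ∧
          ¬ (openGraph (↑x.1 : Set (Sym2 V))).Reachable b c) ∧
        ((openGraph (↑x.2 : Set (Sym2 V))).Reachable a b ∧ (openGraph (↑x.2 : Set (Sym2 V))).Reachable a c) ∧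
        ¬ (openGraph ((↑x.2 : Set (Sym2 V)) \
            {e | ∃ v ∈ {v | (openGraph (↑x.1 : Set (Sym2 V))).Reachable c v}, v ∈ e})).Reachable a b ∧
        ¬ (openGraph ((↑x.2 : Set (Sym2 V)) \
            {e | ∃ v ∈ {v | (openGraph (↑x.1 : Set (Sym2 V))).Reachable b v}, v ∈ e})).Reachable a c ∧
        ¬ (openGraph ((↑x.2 : Set (Sym2 V)) \
            {e | ∃ q ∈ {q | (openGraph ((↑x.2 : Set (Sym2 V)) \
                  {e | ∃ v ∈ {v | (openGraph (↑x.1 : Set (Sym2 V))).Reachable b v}, v ∈ e})).Reachable c q},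
                 ∃ s ∈ {v | (openGraph (↑x.1 : Set (Sym2 V))).Reachable b v}, e = s(q, s)})).Reachable a b ∧
        ¬ (openGraph ((↑x.2 : Set (Sym2 V)) \
            {e | ∃ q ∈ {q | (openGraph ((↑x.2 : Set (Sym2 V)) \
                  {e | ∃ v ∈ {v | (openGraph (↑x.1 : Set (Sym2 V))).Reachable c v}, v ∈ e})).Reachable b q},
                 ∃ s ∈ {v | (openGraph (↑x.1 : Set (Sym2 V))).Reachable c v}, e = s(q, s)})).Reachable a c} with hR0
  set B : Set (Finset (Sym2 V) × Finset (Sym2 V)) := {x : Finset (Sym2 V) × Finset (Sym2 V) |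
        (¬ (openGraph (↑x.1 : Set (Sym2 V))).Reachable a b ∧ ¬ (openGraph (↑x.1 : Set (Sym2 V))).Reachable a c ∧
          ¬ (openGraph (↑x.1 : Set (Sym2 V))).Reachable b c) ∧
        ((openGraph (↑x.2 : Set (Sym2 V))).Reachable a b ∧ (openGraph (↑x.2 : Set (Sym2 V))).Reachable a c) ∧
        ¬ (openGraph ((↑x.2 : Set (Sym2 V)) \
            {e | ∃ v ∈ {v | (openGraph (↑x.1 : Set (Sym2 V))).Reachable c v}, v ∈ e})).Reachable a b ∧
        ¬ (openGraph ((↑x.2 : Set (Sym2 V)) \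
            {e | ∃ v ∈ {v | (openGraph (↑x.1 : Set (Sym2 V))).Reachable b v}, v ∈ e})).Reachable a c} with hB
  have hc : Pr2W D p Kc ≤ PrW Finset.univ p {S : Finset (Sym2 V) | (openGraph (↑S : Set (Sym2 V))).Reachable a b ∧ ¬ (openGraph (↑S : Set (Sym2 V))).Reachable a c} := Pr2W_cut_le p hp0 hp1 a b c
  have hb : Pr2W D p Kb ≤ PrW Finset.univ p {S : Finset (Sym2 V) | (openGraph (↑S : Set (Sym2 V))).Reachable a c ∧ ¬ (openGraph (↑S : Set (Sym2 V))).Reachable a b} := Pr2W_cut_le p hp0 hp1 a c b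
  have hsplit : Pr2W D p B ≤ Pr2W D p Kc + Pr2W D p Kb + Pr2W D p R0 := by
    calc Pr2W D p B ≤ Pr2W D p ((Kc ∪ Kb) ∪ R0) :=
          Pr2W_mono D hp0 hp1 fun x _ _ hx => by
            obtain ⟨hsep, habc, hsc, hsb⟩ := hx
            by_cases h1 : (openGraph ((↑x.2 : Set (Sym2 V)) \
            {e | ∃ q ∈ {q | (openGraph ((↑x.2 : Set (Sym2 V)) \
                  {e | ∃ v ∈ {v | (openGraph (↑x.1 : Set (Sym2 V))).Reachable b v}, v ∈ e})).Reachable c q},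
                 ∃ s ∈ {v | (openGraph (↑x.1 : Set (Sym2 V))).Reachable b v}, e = s(q, s)})).Reachable a b
            · exact Or.inl (Or.inl ⟨hsep.2.2, hsb, h1⟩)
            · by_cases h2 : (openGraph ((↑x.2 : Set (Sym2 V)) \
            {e | ∃ q ∈ {q | (openGraph ((↑x.2 : Set (Sym2 V)) \
                  {e | ∃ v ∈ {v | (openGraph (↑x.1 : Set (Sym2 V))).Reachable c v}, v ∈ e})).Reachable b q},
                 ∃ s ∈ {v | (openGraph (↑x.1 : Set (Sym2 V))).Reachable c v}, e = s(q, s)})).Reachable a c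
              · exact Or.inl (Or.inr ⟨fun h => hsep.2.2 h.symm, hsc, h2⟩)
              · exact Or.inr ⟨hsep, habc, hsc, hsb, h1, h2⟩
      _ ≤ Pr2W D p (Kc ∪ Kb) + Pr2W D p R0 := Pr2W_union_le D hp0 hp1 _ _
      _ ≤ Pr2W D p Kc + Pr2W D p Kb + Pr2W D p R0 := by
          have := Pr2W_union_le D hp0 hp1 Kc Kb; linarith
  linarith

/-- **The product row reduces to the residual `R₀` with constant `2`** (finitary weighted form, every weight vector
`p ∈ [0,1]^{Sym2 V}`): `PrW{abc}·PrW{a|b|c} ≤ 2·(PrW{ab|c} + PrW{ac|b}) + Pr2W(R₀)`, `R₀` = pairs `(C₂, C₁)` (`C₂ ∈ a|b|c`,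
`C₁ ∈ abc`) on which both single seals (p1 g40) and both cut-off swaps (this file) fail.  From ✓ p577001
`productRow_le_add_Pr2W` and `Pr2W_B_le_add_Pr2W_R0`. [this work] -/
theorem productRow_le_two_add_Pr2W (p : Sym2 V → ℝ) (hp0 : ∀ e, 0 ≤ p e) (hp1 : ∀ e, p e ≤ 1) (a b c : V) :
    PrW Finset.univ p {S : Finset (Sym2 V) | (openGraph (↑S : Set (Sym2 V))).Reachable a b ∧ (openGraph (↑S : Set (Sym2 V))).Reachable a c} *
      PrW Finset.univ p {S : Finset (Sym2 V) | ¬ (openGraph (↑S : Set (Sym2 V))).Reachable a b ∧ ¬ (openGraph (↑S : Set (Sym2 V))).Reachable a c ∧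
        ¬ (openGraph (↑S : Set (Sym2 V))).Reachable b c} ≤
    2 * (PrW Finset.univ p {S : Finset (Sym2 V) | (openGraph (↑S : Set (Sym2 V))).Reachable a b ∧ ¬ (openGraph (↑S : Set (Sym2 V))).Reachable a c} +
      PrW Finset.univ p {S : Finset (Sym2 V) | (openGraph (↑S : Set (Sym2 V))).Reachable a c ∧ ¬ (openGraph (↑S : Set (Sym2 V))).Reachable a b}) +
    Pr2W Finset.univ p {x : Finset (Sym2 V) × Finset (Sym2 V) |
        (¬ (openGraph (↑x.1 : Set (Sym2 V))).Reachable a b ∧ ¬ (openGraph (↑x.1 : Set (Sym2 V))).Reachable a c ∧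
          ¬ (openGraph (↑x.1 : Set (Sym2 V))).Reachable b c) ∧
        ((openGraph (↑x.2 : Set (Sym2 V))).Reachable a b ∧ (openGraph (↑x.2 : Set (Sym2 V))).Reachable a c) ∧
        ¬ (openGraph ((↑x.2 : Set (Sym2 V)) \
            {e | ∃ v ∈ {v | (openGraph (↑x.1 : Set (Sym2 V))).Reachable c v}, v ∈ e})).Reachable a b ∧
        ¬ (openGraph ((↑x.2 : Set (Sym2 V)) \
            {e | ∃ v ∈ {v | (openGraph (↑x.1 : Set (Sym2 V))).Reachable b v}, v ∈ e})).Reachable a c ∧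
        ¬ (openGraph ((↑x.2 : Set (Sym2 V)) \
            {e | ∃ q ∈ {q | (openGraph ((↑x.2 : Set (Sym2 V)) \
                  {e | ∃ v ∈ {v | (openGraph (↑x.1 : Set (Sym2 V))).Reachable b v}, v ∈ e})).Reachable c q},
                 ∃ s ∈ {v | (openGraph (↑x.1 : Set (Sym2 V))).Reachable b v}, e = s(q, s)})).Reachable a b ∧
        ¬ (openGraph ((↑x.2 : Set (Sym2 V)) \
            {e | ∃ q ∈ {q | (openGraph ((↑x.2 : Set (Sym2 V)) \
                  {e | ∃ v ∈ {v | (openGraph (↑x.1 : Set (Sym2 V))).Reachable c v}, v ∈ e})).Reachable b q},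
                 ∃ s ∈ {v | (openGraph (↑x.1 : Set (Sym2 V))).Reachable c v}, e = s(q, s)})).Reachable a c} := by
  have h1 := productRow_le_add_Pr2W p hp0 hp1 a b c
  have h2 := Pr2W_B_le_add_Pr2W_R0 p hp0 hp1 a b c
  linarith

/-- **The same reduction for the measure `prodBernoulli w`** (every finite weighted graph; one-configuration terms as
`(prodBernoulli w).real` of the tree's events `openConn`, the pair term in the finitary form `Pr2W univ (w·)`):
`P(a↔b ∧ a↔c)·P(a↮b ∧ a↮c ∧ b↮c) ≤ 2·(P(a↔b ∧ a↮c) + P(a↔c ∧ a↮b)) + Pr2W(R₀)`. [this work] -/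
theorem productRow_le_two_add_Pr2W_prodBernoulli (w : Sym2 V → unitInterval) (a b c : V) :
    (Literature.Probability.LatticeModels.prodBernoulli w).real (openConn a b ∩ openConn a c) *
      (Literature.Probability.LatticeModels.prodBernoulli w).real ((openConn a b)ᶜ ∩ (openConn a c)ᶜ ∩ (openConn b c)ᶜ) ≤
    2 * ((Literature.Probability.LatticeModels.prodBernoulli w).real (openConn a b ∩ (openConn a c)ᶜ) +
      (Literature.Probability.LatticeModels.prodBernoulli w).real (openConn a c ∩ (openConn a b)ᶜ)) +
    Pr2W Finset.univ (fun e => (w e : ℝ)) {x : Finset (Sym2 V) × Finset (Sym2 V) |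
        (¬ (openGraph (↑x.1 : Set (Sym2 V))).Reachable a b ∧ ¬ (openGraph (↑x.1 : Set (Sym2 V))).Reachable a c ∧
          ¬ (openGraph (↑x.1 : Set (Sym2 V))).Reachable b c) ∧
        ((openGraph (↑x.2 : Set (Sym2 V))).Reachable a b ∧ (openGraph (↑x.2 : Set (Sym2 V))).Reachable a c) ∧
        ¬ (openGraph ((↑x.2 : Set (Sym2 V)) \
            {e | ∃ v ∈ {v | (openGraph (↑x.1 : Set (Sym2 V))).Reachable c v}, v ∈ e})).Reachable a b ∧
        ¬ (openGraph ((↑x.2 : Set (Sym2 V)) \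
            {e | ∃ v ∈ {v | (openGraph (↑x.1 : Set (Sym2 V))).Reachable b v}, v ∈ e})).Reachable a c ∧
        ¬ (openGraph ((↑x.2 : Set (Sym2 V)) \
            {e | ∃ q ∈ {q | (openGraph ((↑x.2 : Set (Sym2 V)) \
                  {e | ∃ v ∈ {v | (openGraph (↑x.1 : Set (Sym2 V))).Reachable b v}, v ∈ e})).Reachable c q},
                 ∃ s ∈ {v | (openGraph (↑x.1 : Set (Sym2 V))).Reachable b v}, e = s(q, s)})).Reachable a b ∧
        ¬ (openGraph ((↑x.2 : Set (Sym2 V)) \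
            {e | ∃ q ∈ {q | (openGraph ((↑x.2 : Set (Sym2 V)) \
                  {e | ∃ v ∈ {v | (openGraph (↑x.1 : Set (Sym2 V))).Reachable c v}, v ∈ e})).Reachable b q},
                 ∃ s ∈ {v | (openGraph (↑x.1 : Set (Sym2 V))).Reachable c v}, e = s(q, s)})).Reachable a c} := by
  have h1 := productRow_le_add_Pr2W_prodBernoulli w a b c
  have h2 := Pr2W_B_le_add_Pr2W_R0 (fun e => (w e : ℝ)) (fun e => (w e).2.1) (fun e => (w e).2.2) a b c
  have hdet : ∀ C : Set (BondConfig V), DeterminedBy C (↑(Finset.univ : Finset (Sym2 V)) : Set (Sym2 V)) := by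
    intro C
    rw [determinedBy_iff]
    intro ω ω' h
    rw [Finset.coe_univ, Set.inter_univ, Set.inter_univ] at h
    rw [h]
  have eAB : (Literature.Probability.LatticeModels.prodBernoulli w).real (openConn a b ∩ (openConn a c)ᶜ) =
      PrW Finset.univ (fun e => (w e : ℝ)) {S : Finset (Sym2 V) | (openGraph (↑S : Set (Sym2 V))).Reachable a b ∧ ¬ (openGraph (↑S : Set (Sym2 V))).Reachable a c} :=
    prodBernoulli_real_eq_PrW w (hdet _) fun S _ => Iff.rfl
  have eAC : (Literature.Probability.LatticeModels.prodBernoulli w).real (openConn a c ∩ (openConn a b)ᶜ) =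
      PrW Finset.univ (fun e => (w e : ℝ)) {S : Finset (Sym2 V) | (openGraph (↑S : Set (Sym2 V))).Reachable a c ∧ ¬ (openGraph (↑S : Set (Sym2 V))).Reachable a b} :=
    prodBernoulli_real_eq_PrW w (hdet _) fun S _ => Iff.rfl
  rw [eAB, eAC] at h1 ⊢
  linarith

/-- **The remaining obligation, packaged.**  If the residual set `R₀` (both seals and both cut-offs fail) satisfies
`Pr2W(R₀) ≤ m·(P(ab|c) + P(ac|b))`, then the product row F1 holds with constant `2 + m`:
`P(a↔b ∧ a↔c)·P(a|b|c) ≤ (2+m)·(P(ab|c) + P(ac|b))` on every finite weighted graph; `m ≤ 1` gives the per-apex hypothesis of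
✓ p560550 `ThreePort.le_one_reached_le_of_productRow3` (up to the off-observer restriction handled there).  The memo's census:
`R₀` is empty on every graph with ≤ 5 vertices and every multigraph tested, and tiny beyond (8 configuration classes on 6
vertices, 1572 on 7). [this work] -/
theorem productRow_of_Pr2W_R0_bound (w : Sym2 V → unitInterval) (a b c : V) (m : ℝ)
    (hR0 : Pr2W Finset.univ (fun e => (w e : ℝ)) {x : Finset (Sym2 V) × Finset (Sym2 V) |
        (¬ (openGraph (↑x.1 : Set (Sym2 V))).Reachable a b ∧ ¬ (openGraph (↑x.1 : Set (Sym2 V))).Reachable a c ∧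
          ¬ (openGraph (↑x.1 : Set (Sym2 V))).Reachable b c) ∧
        ((openGraph (↑x.2 : Set (Sym2 V))).Reachable a b ∧ (openGraph (↑x.2 : Set (Sym2 V))).Reachable a c) ∧
        ¬ (openGraph ((↑x.2 : Set (Sym2 V)) \
            {e | ∃ v ∈ {v | (openGraph (↑x.1 : Set (Sym2 V))).Reachable c v}, v ∈ e})).Reachable a b ∧
        ¬ (openGraph ((↑x.2 : Set (Sym2 V)) \
            {e | ∃ v ∈ {v | (openGraph (↑x.1 : Set (Sym2 V))).Reachable b v}, v ∈ e})).Reachable a c ∧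
        ¬ (openGraph ((↑x.2 : Set (Sym2 V)) \
            {e | ∃ q ∈ {q | (openGraph ((↑x.2 : Set (Sym2 V)) \
                  {e | ∃ v ∈ {v | (openGraph (↑x.1 : Set (Sym2 V))).Reachable b v}, v ∈ e})).Reachable c q},
                 ∃ s ∈ {v | (openGraph (↑x.1 : Set (Sym2 V))).Reachable b v}, e = s(q, s)})).Reachable a b ∧
        ¬ (openGraph ((↑x.2 : Set (Sym2 V)) \
            {e | ∃ q ∈ {q | (openGraph ((↑x.2 : Set (Sym2 V)) \
                  {e | ∃ v ∈ {v | (openGraph (↑x.1 : Set (Sym2 V))).Reachable c v}, v ∈ e})).Reachable b q},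
                 ∃ s ∈ {v | (openGraph (↑x.1 : Set (Sym2 V))).Reachable c v}, e = s(q, s)})).Reachable a c} ≤
      m * ((Literature.Probability.LatticeModels.prodBernoulli w).real (openConn a b ∩ (openConn a c)ᶜ) +
        (Literature.Probability.LatticeModels.prodBernoulli w).real (openConn a c ∩ (openConn a b)ᶜ))) :
    (Literature.Probability.LatticeModels.prodBernoulli w).real (openConn a b ∩ openConn a c) *
      (Literature.Probability.LatticeModels.prodBernoulli w).real ((openConn a b)ᶜ ∩ (openConn a c)ᶜ ∩ (openConn b c)ᶜ) ≤
    (2 + m) * ((Literature.Probability.LatticeModels.prodBernoulli w).real (openConn a b ∩ (openConn a c)ᶜ) +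
      (Literature.Probability.LatticeModels.prodBernoulli w).real (openConn a c ∩ (openConn a b)ᶜ)) := by
  have h := productRow_le_two_add_Pr2W_prodBernoulli w a b c
  linarith

end Reduction

end ThreeClusterSwap

end Summit.CriticalPhenomena.PercolationContinuityZ3.Theorems
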